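import Literature.Probability.LatticeModels.RandomCurrentsProofs
import HarnessLib

/-!
# The mean signed current of Aizenman's backbone walk (sourced random currents, discrete torus)

Topic `Literature/Probability/LatticeModels`, namespace `Literature.Probability.LatticeModels`
(walk machinery in `….Current.Backbone`).

For a current `n` on a finite graph with sources `∂n = {a} ∆ {b}`, M. Aizenman, *Geometric analysis
of `φ⁴` fields and Ising models*, Comm. Math. Phys. **86** (1982), §9 (i)–(iv) (p. 23) constructs a
walk from `a` to `b` along the bonds of `n`: at each step a bond at the current site not examined
before is chosen, *traversed* if `n_b` is odd and only *attempted* if `n_b` is even; the walk stops at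
the first hit of `b` ("if `∂n = {x, y}` then any nonrepeating path along bonds with odd values of `n`
which starts at `x`, eventually reaches `y`"). Its set of examined bonds is the *backbone*.
Here the bonds are examined in the order of an injective *ranking* `rk` of the edges (a
deterministic rule; averaging over all rankings restores the symmetry of the graph), exactly as in
`Literature.Probability.LatticeModels.Current.exploreAt` (`CurrentExploration.lean`), of which the
present walk `Current.Backbone.walk` is the projection to the three coordinates (current site, used
bonds, halting flag) that drive it (same step function, field by field). As there, only bonds carrying
a non-zero current are examined and the zero bonds ranked below the examined one are marked *used*
(skipped) in the same step; compared with Aizenman's rule this only deletes steps without a move, so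
the sequence of traversed bonds — and every flux below — is unchanged. This file deliberately imports
only `RandomCurrentsProofs`, so that statements about the mean current do not depend on the
Gibbs-state part of the library (`CurrentExploration.lean` does, through `CurrentClusters`).

## Main definitions

* `Current.Backbone.walk rk n Y a k`: the state after `k` steps of the walk of the current `n` started
  at `a` with target set `Y`.
* `Current.Backbone.flux rk n Y a v w : ℝ`: the signed number of steps of the walk along the oriented
  bond `(v, w)` (steps `v → w` minus steps `w → v`).
* `backboneMeanFlux G β a b v w`: its mean under the *sourced random-current law*
  `P^{a,b}_{G,β}(n) ∝ 1{∂n = {a} ∆ {b}} w_β(n)` (Aizenman 1982, §9; Aizenman–Duminil-Copin–Sidoravicius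
  2015, §2.1, Definition 2.1 and the display for `⟨σ_x σ_y⟩⁰`), walk from `a` with target `{b}`,
  averaged over all rankings `e ↦ #σ(e)`, `σ` a permutation of the edges.
* `torusBackboneMeanCurrent β N x y u i`: the case of the discrete torus `(ℤ/(N+1)ℤ)^d`
  (`torusGraph d (N+1)`), sources the projections of `x y : ℤ^d`, bond `(u, u + eᵢ)` projected.

## Main statements

* `torusBackboneMeanCurrent_eq`: unfolding to the explicit ranking average / `tsum` formula.
* `Current.Backbone.walk_done_of_sources_eq` (Aizenman's observation, 1982, p. 23): if
  `∂n = {a} ∆ {b}` the walk from `a` with target `{b}` has halted at `b` after `|E| + 1` steps.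
* `Current.Backbone.abs_flux_le_one`, `abs_backboneMeanFlux_le_one`, `abs_torusBackboneMeanCurrent_le_one`:
  a bond is traversed at most once, so all these currents lie in `[-1, 1]` (`0 ≤ β`).
* `sum_backboneMeanFlux_eq` (Kirchhoff's node law in expectation): for `currentSum ≠ 0`,
  `∑_w backboneMeanFlux G β a b v w = 1{v = a} - 1{v = b}`.
* `torusBackboneMeanCurrent_kirchhoff`: for `2 ≤ N` and `0 < β`,
  `∑ᵢ (J_N(x,y;u,i) - J_N(x,y;u-eᵢ,i)) = 1{ū = x̄} - 1{ū = ȳ}` (bars: projections to the torus).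

## References

* M. Aizenman, Comm. Math. Phys. 86 (1982) 1–48, §9 (pp. 23–27) [AizenmanCMP1982].
* M. Aizenman, H. Duminil-Copin, V. Sidoravicius, *Random currents and continuity of Ising model's
  spontaneous magnetization*, Comm. Math. Phys. 334 (2015), §2 [AizenmanDuminilCopinSidoravicius2015].
* H. Duminil-Copin, *Random currents expansion of the Ising model*, arXiv:1607.06933 (2016), §2.
-/

noncomputable section

open Finset
open scoped symmDiff

namespace Literature.Probability.LatticeModels

variable {V : Type*} [Fintype V] [DecidableEq V] {G : SimpleGraph V} [DecidableRel G.Adj]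

namespace Current

namespace Backbone

/-! ### The far end of a bond -/

/-- The far end of the bond `e` seen from `v` (`v` itself if `v ∉ e`); definitionally
`Current.otherEnd` of `CurrentExploration.lean`. [folklore] -/
def farEnd (e : G.edgeFinset) (v : V) : V :=
  if h : v ∈ (e : Sym2 V) then Sym2.Mem.other' h else v

/-- Bookkeeping lemma for the backbone walk. [folklore] -/
theorem farEnd_spec {e : G.edgeFinset} {v : V} (h : v ∈ (e : Sym2 V)) :
    s(v, farEnd e v) = (e : Sym2 V) := by
  rw [farEnd, dif_pos h]; exact Sym2.other_spec' h

/-- Bookkeeping lemma for the backbone walk. [folklore] -/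
theorem farEnd_mem {e : G.edgeFinset} {v : V} (h : v ∈ (e : Sym2 V)) : farEnd e v ∈ (e : Sym2 V) := by
  rw [farEnd, dif_pos h]; exact Sym2.other_mem' h

/-- Bookkeeping lemma for the backbone walk. [folklore] -/
theorem adj_farEnd {e : G.edgeFinset} {v : V} (h : v ∈ (e : Sym2 V)) : G.Adj v (farEnd e v) := by
  have he : (e : Sym2 V) ∈ G.edgeSet := SimpleGraph.mem_edgeFinset.mp e.2
  rw [← farEnd_spec h] at he
  exact he

/-- Bookkeeping lemma for the backbone walk. [folklore] -/
theorem farEnd_ne {e : G.edgeFinset} {v : V} (h : v ∈ (e : Sym2 V)) : farEnd e v ≠ v :=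
  (adj_farEnd h).ne'

/-- Bookkeeping lemma for the backbone walk. [folklore] -/
theorem mem_iff_eq_or_eq_farEnd {e : G.edgeFinset} {v : V} (h : v ∈ (e : Sym2 V)) (w : V) :
    w ∈ (e : Sym2 V) ↔ w = v ∨ w = farEnd e v := by
  rw [← farEnd_spec h, Sym2.mem_iff]

/-! ### States and one step of the walk -/

/-- A state of the backbone walk: the current site `pos`, the set `used` of bonds already examined
or skipped, and the halting flag `done` (the three coordinates of `Current.XState` that determine
the evolution). [folklore] -/
structure State (G : SimpleGraph V) [DecidableRel G.Adj] where
  /-- current site -/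
  pos : V
  /-- used bonds (examined or skipped) -/
  used : Finset G.edgeFinset
  /-- halting flag -/
  done : Bool
  deriving DecidableEq

variable (rk : G.edgeFinset → ℕ) (n : Current G) (Y : Finset V)

/-- The initial state of the walk started at `a`. [folklore] -/
def init (a : V) : State G := { pos := a, used := ∅, done := false }

/-- The unused bonds at the current site. [folklore] -/
def unused (s : State G) : Finset G.edgeFinset :=
  univ.filter fun e => s.pos ∈ (e : Sym2 V) ∧ e ∉ s.used

/-- The bonds the walk may examine: unused bonds at the current site carrying a non-zero current
(Aizenman 1982, §9 (ii)). [cite: AizenmanCMP1982, §9 (ii) (p. 23)] -/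
def avail (s : State G) : Finset G.edgeFinset := (unused s).filter fun e => n e ≠ 0

/-- Examination of the bond `e` from the state `s` (Aizenman 1982, §9 (iii)): `e` and the unused
bonds at the current site ranked below it are marked used; if `n_e` is odd the walk traverses `e`,
otherwise it stays. [cite: AizenmanCMP1982, §9 (iii) (p. 23)] -/
def advance (s : State G) (e : G.edgeFinset) : State G :=
  { pos := if Odd (n e) then farEnd e s.pos else s.pos
    used := s.used ∪ (unused s).filter fun e' => rk e' ≤ rk e
    done := false }

/-- One step of the walk with target set `Y` (Aizenman 1982, §9 (ii)–(iv)): a halted state is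
fixed; at a site of `Y` the walk halts; otherwise it examines the available bond of least rank, and
if there is none it marks the unused bonds at the site and halts. [cite: AizenmanCMP1982, §9 (ii)–(iv) (p. 23)] -/
def step (s : State G) : State G :=
  if s.done then s
  else if s.pos ∈ Y then { s with done := true }
  else if h : (avail n s).Nonempty then
    advance rk n s (Function.argminOn rk (↑(avail n s) : Set G.edgeFinset) h)
  else { s with used := s.used ∪ unused s, done := true }

/-- The state of the walk started at `a` after `k` steps. [cite: AizenmanCMP1982, §9 (i)–(iv) (p. 23)] -/
def walk (a : V) (k : ℕ) : State G := (step rk n Y)^[k] (init a)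

/-- The **signed flux** of the walk from `a` (target `Y`) through the oriented bond `(v, w)`: the
number of steps from `v` to `w` minus the number of steps from `w` to `v`, among the first `|E| + 1`
steps (after which the walk has halted, `Current.Backbone.done_walk_card`). [folklore] -/
def flux (a v w : V) : ℝ :=
  ∑ k ∈ range (Fintype.card G.edgeFinset + 1),
    ((if (walk rk n Y a k).pos = v ∧ (walk rk n Y a (k + 1)).pos = w then (1 : ℝ) else 0) -
      (if (walk rk n Y a k).pos = w ∧ (walk rk n Y a (k + 1)).pos = v then (1 : ℝ) else 0))

/-- Bookkeeping lemma for the backbone walk. [folklore] -/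
theorem walk_zero (a : V) : walk rk n Y a 0 = init a := rfl

/-- Bookkeeping lemma for the backbone walk. [folklore] -/
theorem walk_succ (a : V) (k : ℕ) : walk rk n Y a (k + 1) = step rk n Y (walk rk n Y a k) :=
  Function.iterate_succ_apply' _ _ _

/-! ### Case analysis of one step -/

section Step

variable {rk n Y}

/-- The stuck state: the unused bonds at the site are marked and the walk halts. [folklore] -/
def stuck (s : State G) : State G := { s with used := s.used ∪ unused s, done := true }

/-- Bookkeeping lemma for the backbone walk. [folklore] -/
theorem step_of_done {s : State G} (h : s.done = true) : step rk n Y s = s := by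
  simp [step, h]

/-- Bookkeeping lemma for the backbone walk. [folklore] -/
theorem step_of_mem {s : State G} (h : s.done = false) (hY : s.pos ∈ Y) :
    step rk n Y s = { s with done := true } := by
  simp [step, h, hY]

/-- Bookkeeping lemma for the backbone walk. [folklore] -/
theorem step_of_nonempty {s : State G} (h : s.done = false) (hY : s.pos ∉ Y)
    (hA : (avail n s).Nonempty) :
    step rk n Y s = advance rk n s (Function.argminOn rk (↑(avail n s) : Set G.edgeFinset) hA) := by
  simp [step, h, hY, hA]

/-- Bookkeeping lemma for the backbone walk. [folklore] -/
theorem step_of_empty {s : State G} (h : s.done = false) (hY : s.pos ∉ Y)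
    (hA : ¬ (avail n s).Nonempty) : step rk n Y s = stuck s := by
  simp [step, h, hY, hA, stuck]

/-- The four cases of a step. [folklore] -/
theorem step_cases (s : State G) :
    (s.done = true ∧ step rk n Y s = s) ∨
    (s.done = false ∧ s.pos ∈ Y ∧ step rk n Y s = { s with done := true }) ∨
    (s.done = false ∧ s.pos ∉ Y ∧ ∃ hA : (avail n s).Nonempty, step rk n Y s =
      advance rk n s (Function.argminOn rk (↑(avail n s) : Set G.edgeFinset) hA)) ∨
    (s.done = false ∧ s.pos ∉ Y ∧ avail n s = ∅ ∧ step rk n Y s = stuck s) := by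
  by_cases h : s.done = true
  · exact Or.inl ⟨h, step_of_done h⟩
  rw [Bool.not_eq_true] at h
  by_cases hY : s.pos ∈ Y
  · exact Or.inr (Or.inl ⟨h, hY, step_of_mem h hY⟩)
  by_cases hA : (avail n s).Nonempty
  · exact Or.inr (Or.inr (Or.inl ⟨h, hY, hA, step_of_nonempty h hY hA⟩))
  · exact Or.inr (Or.inr (Or.inr ⟨h, hY, not_nonempty_iff_eq_empty.mp hA, step_of_empty h hY hA⟩))

/-- Bookkeeping lemma for the backbone walk. [folklore] -/
theorem mem_unused {s : State G} {e : G.edgeFinset} :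
    e ∈ unused s ↔ s.pos ∈ (e : Sym2 V) ∧ e ∉ s.used := by
  simp [unused]

/-- Bookkeeping lemma for the backbone walk. [folklore] -/
theorem mem_avail {s : State G} {e : G.edgeFinset} :
    e ∈ avail n s ↔ (s.pos ∈ (e : Sym2 V) ∧ e ∉ s.used) ∧ n e ≠ 0 := by
  simp [avail, unused]

/-- The examined bond is available. [folklore] -/
theorem argminOn_mem_avail {s : State G} (hA : (avail n s).Nonempty) :
    Function.argminOn rk (↑(avail n s) : Set G.edgeFinset) hA ∈ avail n s :=
  Function.argminOn_mem rk _ hA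

/-- No available bond has smaller rank than the examined one. [folklore] -/
theorem rk_argminOn_le {s : State G} (hA : (avail n s).Nonempty) {e : G.edgeFinset}
    (he : e ∈ avail n s) :
    rk (Function.argminOn rk (↑(avail n s) : Set G.edgeFinset) hA) ≤ rk e :=
  Function.argminOn_le rk (↑(avail n s) : Set G.edgeFinset) (Finset.mem_coe.mpr he)

/-- A bond marked together with the examined bond carries no current if its rank is smaller. [folklore] -/
theorem apply_eq_zero_of_rk_lt {s : State G} (hA : (avail n s).Nonempty) {e' : G.edgeFinset}
    (he' : e' ∈ unused s)
    (hlt : rk e' < rk (Function.argminOn rk (↑(avail n s) : Set G.edgeFinset) hA)) : n e' = 0 := by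
  by_contra hne
  exact absurd (rk_argminOn_le (rk := rk) hA (mem_avail.mpr ⟨mem_unused.mp he', hne⟩)) (not_le.mpr hlt)

/-! ### Monotonicity -/

/-- `advance` only adds used bonds. [folklore] -/
theorem used_subset_advance (s : State G) (e : G.edgeFinset) :
    s.used ⊆ (advance rk n s e).used := subset_union_left

/-- Bookkeeping lemma for the backbone walk. [folklore] -/
theorem used_subset_step (s : State G) : s.used ⊆ (step rk n Y s).used := by
  rcases step_cases (rk := rk) (n := n) (Y := Y) s with ⟨-, h⟩ | ⟨-, -, h⟩ | ⟨-, -, hA, h⟩ | ⟨-, -, -, h⟩ <;>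
    rw [h]
  · exact used_subset_advance s _
  · exact subset_union_left

/-- Bookkeeping lemma for the backbone walk. [folklore] -/
theorem done_step_of_done {s : State G} (h : s.done = true) : (step rk n Y s).done = true := by
  rw [step_of_done h]; exact h

/-- A bond used for the first time in a step and carrying a non-zero current is the examined bond. [folklore] -/
theorem eq_argminOn_of_mem_used_step (hrk : Function.Injective rk) {s : State G} {e : G.edgeFinset}
    (he : e ∉ s.used) (he' : e ∈ (step rk n Y s).used) (hne : n e ≠ 0) :
    ∃ (_ : s.done = false) (_ : s.pos ∉ Y) (hA : (avail n s).Nonempty),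
      e = Function.argminOn rk (↑(avail n s) : Set G.edgeFinset) hA := by
  rcases step_cases (rk := rk) (n := n) (Y := Y) s with ⟨-, h⟩ | ⟨-, -, h⟩ | ⟨hd, hY, hA, h⟩ | ⟨-, -, hA, h⟩ <;>
    rw [h] at he'
  · exact absurd he' he
  · exact absurd he' he
  · refine ⟨hd, hY, hA, ?_⟩
    simp only [advance, mem_union, mem_filter] at he'
    rcases he' with he' | ⟨he', hle⟩
    · exact absurd he' he
    rcases hle.lt_or_eq with hlt | heq
    · exact absurd (apply_eq_zero_of_rk_lt hA he' hlt) hne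
    · exact hrk heq
  · simp only [stuck, mem_union] at he'
    rcases he' with he' | he'
    · exact absurd he' he
    · have : e ∉ avail n s := by rw [hA]; exact notMem_empty e
      rw [mem_avail, not_and, not_not] at this
      exact absurd (this (mem_unused.mp he')) hne

end Step

/-! ### Invariants of the walk -/

section Run

variable {rk n Y}

/-- Bookkeeping lemma for the backbone walk. [folklore] -/
theorem done_walk_mono {a : V} {k k' : ℕ} (hk : k ≤ k') (h : (walk rk n Y a k).done = true) :
    (walk rk n Y a k').done = true := by
  induction hk with
  | refl => exact h
  | step _ ih => rw [walk_succ]; exact done_step_of_done ih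

/-- Bookkeeping lemma for the backbone walk. [folklore] -/
theorem used_walk_mono {a : V} {k k' : ℕ} (hk : k ≤ k') :
    (walk rk n Y a k).used ⊆ (walk rk n Y a k').used := by
  induction hk with
  | refl => rfl
  | step _ ih => rw [walk_succ]; exact ih.trans (used_subset_step _)

/-- A halted walk does not move any more. [folklore] -/
theorem walk_eq_of_done {a : V} {k k' : ℕ} (hk : k ≤ k') (h : (walk rk n Y a k).done = true) :
    walk rk n Y a k' = walk rk n Y a k := by
  induction hk with
  | refl => rfl
  | step hle ih => rw [walk_succ, ih, step_of_done h]

/-- Bookkeeping lemma for the backbone walk. [folklore] -/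
theorem done_eq_false_of_le {a : V} {k k' : ℕ} (hk : k ≤ k') (h : (walk rk n Y a k').done = false) :
    (walk rk n Y a k).done = false := by
  by_contra hc
  rw [Bool.not_eq_false] at hc
  have := done_walk_mono hk hc
  rw [h] at this
  exact Bool.false_ne_true this

/-- While the walk has not halted it has used at least as many bonds as steps taken. [folklore] -/
theorem le_card_used_walk (a : V) (k : ℕ) (h : (walk rk n Y a k).done = false) :
    k ≤ (walk rk n Y a k).used.card := by
  induction k with
  | zero => exact Nat.zero_le _
  | succ k ih =>
    have hk : (walk rk n Y a k).done = false := done_eq_false_of_le (Nat.le_succ k) h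
    have ih' := ih hk
    rw [walk_succ] at h ⊢
    set s := walk rk n Y a k
    rcases step_cases (rk := rk) (n := n) (Y := Y) s with ⟨hd, -⟩ | ⟨-, -, hs⟩ | ⟨-, -, hA, hs⟩ | ⟨-, -, -, hs⟩
    · rw [hk] at hd; exact absurd hd Bool.false_ne_true
    · rw [hs] at h; simp at h
    · rw [hs]
      have heA := mem_avail.mp (argminOn_mem_avail (rk := rk) hA)
      have hss : s.used ⊂ (advance rk n s
          (Function.argminOn rk (↑(avail n s) : Set G.edgeFinset) hA)).used := by
        refine Finset.ssubset_iff_subset_ne.mpr ⟨used_subset_advance _ _, fun heq => heA.1.2 ?_⟩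
        rw [heq]
        simp only [advance, mem_union, mem_filter]
        exact Or.inr ⟨mem_unused.mpr heA.1, le_rfl⟩
      have := Finset.card_lt_card hss
      omega
    · rw [hs] at h; simp [stuck] at h

/-- **The walk has halted after `|E| + 1` steps.** [folklore] -/
theorem done_walk_card (a : V) : (walk rk n Y a (Fintype.card G.edgeFinset + 1)).done = true := by
  by_contra hc
  rw [Bool.not_eq_true] at hc
  have h1 := le_card_used_walk (rk := rk) (n := n) (Y := Y) a _ hc
  have h2 : (walk rk n Y a (Fintype.card G.edgeFinset + 1)).used.card ≤ Fintype.card G.edgeFinset :=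
    Finset.card_le_univ _
  omega

/-- After `|E| + 1` steps the walk does not move. [folklore] -/
theorem walk_eq_walk_card (a : V) {k : ℕ} (hk : Fintype.card G.edgeFinset + 1 ≤ k) :
    walk rk n Y a k = walk rk n Y a (Fintype.card G.edgeFinset + 1) :=
  walk_eq_of_done hk (done_walk_card a)

end Run

/-! ### One step moves along a traversed bond -/

section Move

variable {rk n Y}

/-- **Anatomy of a move.** If a step changes the current site, it is the examination of the
available bond `e` of least rank, `n_e` is odd, the walk moves to the far end of `e`, and `e` is used
for the first time. [folklore] -/
theorem exists_of_pos_step_ne {s : State G} (h : (step rk n Y s).pos ≠ s.pos) :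
    ∃ (_ : s.done = false) (_ : s.pos ∉ Y) (hA : (avail n s).Nonempty),
      step rk n Y s = advance rk n s (Function.argminOn rk (↑(avail n s) : Set G.edgeFinset) hA) ∧
      Odd (n (Function.argminOn rk (↑(avail n s) : Set G.edgeFinset) hA)) ∧
      (step rk n Y s).pos = farEnd (Function.argminOn rk (↑(avail n s) : Set G.edgeFinset) hA) s.pos := by
  rcases step_cases (rk := rk) (n := n) (Y := Y) s with ⟨-, hs⟩ | ⟨-, -, hs⟩ | ⟨hd, hY, hA, hs⟩ | ⟨-, -, -, hs⟩
  · rw [hs] at h; exact absurd rfl h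
  · rw [hs] at h; exact absurd rfl h
  · refine ⟨hd, hY, hA, hs, ?_⟩
    rw [hs] at h ⊢
    simp only [advance] at h ⊢
    by_cases ho : Odd (n (Function.argminOn rk (↑(avail n s) : Set G.edgeFinset) hA))
    · exact ⟨ho, by rw [if_pos ho]⟩
    · rw [if_neg ho] at h; exact absurd rfl h
  · rw [hs] at h; exact absurd rfl h

/-- A move goes along a bond of the graph: consecutive distinct sites are adjacent. [folklore] -/
theorem adj_of_pos_step_ne {s : State G} (h : (step rk n Y s).pos ≠ s.pos) :
    G.Adj s.pos (step rk n Y s).pos := by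
  obtain ⟨-, -, hA, -, -, hpos⟩ := exists_of_pos_step_ne h
  rw [hpos]
  exact adj_farEnd (mem_avail.mp (argminOn_mem_avail (rk := rk) hA)).1.1

/-- The bond along which a move goes is unused before and used after the step. [folklore] -/
theorem exists_edge_of_pos_step_ne {s : State G} (h : (step rk n Y s).pos ≠ s.pos) :
    ∃ e : G.edgeFinset, (e : Sym2 V) = s(s.pos, (step rk n Y s).pos) ∧ e ∉ s.used ∧
      e ∈ (step rk n Y s).used := by
  obtain ⟨-, -, hA, hs, -, hpos⟩ := exists_of_pos_step_ne h
  have heA := mem_avail.mp (argminOn_mem_avail (rk := rk) hA)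
  refine ⟨_, ?_, heA.1.2, ?_⟩
  · rw [hpos, farEnd_spec heA.1.1]
  · rw [hs]
    simp only [advance, mem_union, mem_filter]
    exact Or.inr ⟨mem_unused.mpr heA.1, le_rfl⟩

/-- Consecutive distinct sites of the walk are adjacent. [folklore] -/
theorem adj_of_pos_walk_succ_ne {a : V} {k : ℕ} (h : (walk rk n Y a (k + 1)).pos ≠ (walk rk n Y a k).pos) :
    G.Adj (walk rk n Y a k).pos (walk rk n Y a (k + 1)).pos := by
  rw [walk_succ] at h ⊢; exact adj_of_pos_step_ne h

/-- **A bond is traversed at most once**: two moves of the walk along the same bond happen at the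
same step. [folklore] -/
theorem eq_of_moves {a : V} {k k' : ℕ}
    (hk : (walk rk n Y a (k + 1)).pos ≠ (walk rk n Y a k).pos)
    (hk' : (walk rk n Y a (k' + 1)).pos ≠ (walk rk n Y a k').pos)
    (he : s((walk rk n Y a k).pos, (walk rk n Y a (k + 1)).pos) =
      s((walk rk n Y a k').pos, (walk rk n Y a (k' + 1)).pos)) : k = k' := by
  by_contra hne
  wlog hlt : k < k' generalizing k k'
  · exact this hk' hk he.symm (Ne.symm hne) (lt_of_le_of_ne (not_lt.mp hlt) (Ne.symm hne))
  rw [walk_succ rk n Y a k] at hk he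
  rw [walk_succ rk n Y a k'] at hk' he
  obtain ⟨e, he1, -, he3⟩ := exists_edge_of_pos_step_ne hk
  obtain ⟨e', he1', he2', -⟩ := exists_edge_of_pos_step_ne hk'
  have hee' : e = e' := Subtype.ext (by rw [he1, he1', he])
  rw [← walk_succ] at he3
  exact he2' (hee' ▸ used_walk_mono (Nat.succ_le_of_lt hlt) he3)

end Move

/-! ### The flux through a bond lies in `{-1, 0, 1}` -/

section Flux

variable {rk n Y}

/-- Bookkeeping lemma for the backbone walk: the flux through a degenerate bond vanishes. [folklore] -/
theorem flux_self (a v : V) : flux rk n Y a v v = 0 := by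
  simp [flux]

/-- The flux is antisymmetric in the bond. [folklore] -/
theorem flux_swap (a v w : V) : flux rk n Y a w v = -flux rk n Y a v w := by
  simp only [flux, ← Finset.sum_neg_distrib, neg_sub]

/-- **A bond is traversed at most once, so the flux through it is `-1`, `0` or `1`.** [folklore] -/
theorem abs_flux_le_one (a v w : V) : |flux rk n Y a v w| ≤ 1 := by
  unfold flux
  set f : ℕ → ℝ := fun k =>
    (if (walk rk n Y a k).pos = v ∧ (walk rk n Y a (k + 1)).pos = w then (1 : ℝ) else 0) -
      (if (walk rk n Y a k).pos = w ∧ (walk rk n Y a (k + 1)).pos = v then (1 : ℝ) else 0) with hf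
  have hmove : ∀ k, f k ≠ 0 → (walk rk n Y a (k + 1)).pos ≠ (walk rk n Y a k).pos ∧
      s((walk rk n Y a k).pos, (walk rk n Y a (k + 1)).pos) = s(v, w) := by
    intro k hk
    by_cases h1 : (walk rk n Y a k).pos = v ∧ (walk rk n Y a (k + 1)).pos = w
    · by_cases h2 : (walk rk n Y a k).pos = w ∧ (walk rk n Y a (k + 1)).pos = v
      · have hvw : v = w := h1.1.symm.trans h2.1
        subst hvw
        simp [hf] at hk
      · have hvw : v ≠ w := fun hvw => h2 ⟨h1.1.trans hvw, h1.2.trans hvw.symm⟩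
        rw [h1.1, h1.2]
        exact ⟨hvw.symm, rfl⟩
    · by_cases h2 : (walk rk n Y a k).pos = w ∧ (walk rk n Y a (k + 1)).pos = v
      · have hvw : v ≠ w := fun hvw => h1 ⟨h2.1.trans hvw.symm, h2.2.trans hvw⟩
        rw [h2.1, h2.2]
        exact ⟨hvw, Sym2.eq_swap⟩
      · simp [hf, h1, h2] at hk
  have hcard : ((range (Fintype.card G.edgeFinset + 1)).filter fun k => f k ≠ 0).card ≤ 1 := by
    refine Finset.card_le_one.mpr fun k hk k' hk' => ?_
    rw [mem_filter] at hk hk'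
    obtain ⟨m1, e1⟩ := hmove k hk.2
    obtain ⟨m1', e1'⟩ := hmove k' hk'.2
    exact eq_of_moves m1 m1' (e1.trans e1'.symm)
  have hbound : ∀ k, |f k| ≤ 1 := by
    intro k
    simp only [hf]
    split_ifs <;> norm_num
  rw [← Finset.sum_filter_ne_zero]
  refine (Finset.abs_sum_le_sum_abs _ _).trans ?_
  refine (Finset.sum_le_sum fun k _ => hbound k).trans ?_
  rw [Finset.sum_const, nsmul_eq_mul, mul_one]
  exact Nat.cast_le_one.mpr hcard

/-- **Telescoping**: the total flux out of `v` is `1{v = a} - 1{v = final site}`. [folklore] -/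
theorem sum_flux_eq (a v : V) :
    ∑ w, flux rk n Y a v w =
      (if v = a then 1 else 0) - (if v = (walk rk n Y a (Fintype.card G.edgeFinset + 1)).pos then 1 else 0) := by
  simp only [flux]
  rw [Finset.sum_comm]
  have hk : ∀ k, ∑ w, ((if (walk rk n Y a k).pos = v ∧ (walk rk n Y a (k + 1)).pos = w then (1 : ℝ) else 0) -
      (if (walk rk n Y a k).pos = w ∧ (walk rk n Y a (k + 1)).pos = v then (1 : ℝ) else 0)) =
      (if v = (walk rk n Y a k).pos then (1 : ℝ) else 0) - (if v = (walk rk n Y a (k + 1)).pos then 1 else 0) := by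
    intro k
    rw [Finset.sum_sub_distrib]
    congr 1
    · by_cases h : v = (walk rk n Y a k).pos
      · rw [if_pos h]
        simp [h.symm]
      · rw [if_neg h]
        exact Finset.sum_eq_zero fun w _ => if_neg fun h' => h h'.1.symm
    · by_cases h : v = (walk rk n Y a (k + 1)).pos
      · rw [if_pos h]
        simp [h.symm]
      · rw [if_neg h]
        exact Finset.sum_eq_zero fun w _ => if_neg fun h' => h h'.2.symm
  simp only [hk]
  rw [Finset.sum_range_sub']
  simp [walk_zero, init]

end Flux

/-! ### The traversed bonds form a trail from the start to the current site -/

section Trail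

variable {rk n Y}

/-- The number of traversed bonds (used bonds with odd current) at the site `v`. [folklore] -/
def travAt (n : Current G) (s : State G) (v : V) : ℕ :=
  ∑ e ∈ s.used, if Odd (n e) ∧ v ∈ (e : Sym2 V) then 1 else 0

/-- Bookkeeping lemma for the backbone walk. [folklore] -/
theorem travAt_init (a v : V) : travAt n (init (G := G) a) v = 0 := by simp [travAt, init]

/-- One step changes the traversal count at `v` plus the indicator of the current site by an even
amount. [folklore] -/
theorem even_travAt_step_add (hrk : Function.Injective rk) (s : State G) (v : V) :
    Even (travAt n (step rk n Y s) v + (if v = (step rk n Y s).pos then 1 else 0) +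
      (travAt n s v + (if v = s.pos then 1 else 0))) := by
  rcases step_cases (rk := rk) (n := n) (Y := Y) s with ⟨-, h⟩ | ⟨-, -, h⟩ | ⟨-, -, hA, h⟩ | ⟨-, -, hA, h⟩ <;>
    rw [h]
  · exact ⟨_, rfl⟩
  · exact ⟨travAt n s v + (if v = s.pos then 1 else 0), rfl⟩
  · set e := Function.argminOn rk (↑(avail n s) : Set G.edgeFinset) hA with he_def
    set M := (unused s).filter fun e' => rk e' ≤ rk e with hM
    have heA : (s.pos ∈ (e : Sym2 V) ∧ e ∉ s.used) ∧ n e ≠ 0 :=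
      mem_avail.mp (argminOn_mem_avail (rk := rk) hA)
    have heM : e ∈ M := mem_filter.mpr ⟨mem_unused.mpr heA.1, le_rfl⟩
    have hdisj : Disjoint s.used M := by
      rw [Finset.disjoint_left]
      intro e' he' hM'
      exact (mem_unused.mp (mem_filter.mp hM').1).2 he'
    have hsumM : (∑ e' ∈ M, if Odd (n e') ∧ v ∈ (e' : Sym2 V) then 1 else 0 : ℕ) =
        if Odd (n e) ∧ v ∈ (e : Sym2 V) then 1 else 0 := by
      refine Finset.sum_eq_single_of_mem e heM fun e' he' hne => ?_
      have hle := (mem_filter.mp he').2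
      rcases hle.lt_or_eq with hlt | heq
      · simp [apply_eq_zero_of_rk_lt hA (mem_filter.mp he').1 hlt]
      · exact absurd (hrk heq) hne
    have htrav : travAt n (advance rk n s e) v =
        travAt n s v + if Odd (n e) ∧ v ∈ (e : Sym2 V) then 1 else 0 := by
      simp only [travAt, advance]
      rw [Finset.sum_union hdisj, hsumM]
    rw [htrav]
    simp only [advance]
    by_cases ho : Odd (n e)
    · simp only [ho, true_and, if_true]
      have hne : farEnd e s.pos ≠ s.pos := farEnd_ne heA.1.1
      by_cases hv1 : v = s.pos
      · subst hv1
        simp only [if_true, if_neg hne.symm, if_pos heA.1.1]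
        exact ⟨travAt n s s.pos + 1, by ring⟩
      · by_cases hv2 : v = farEnd e s.pos
        · subst hv2
          simp only [if_true, if_neg hv1, if_pos (farEnd_mem heA.1.1)]
          exact ⟨travAt n s (farEnd e s.pos) + 1, by ring⟩
        · have hv : v ∉ (e : Sym2 V) := fun h =>
            ((mem_iff_eq_or_eq_farEnd heA.1.1 v).mp h).elim hv1 hv2
          simp only [if_neg hv1, if_neg hv2, if_neg hv]
          exact ⟨travAt n s v, by ring⟩
    · simp only [ho, false_and, if_false]
      exact ⟨travAt n s v + (if v = s.pos then 1 else 0), by ring⟩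
  · have hM : (∑ e' ∈ unused s, if Odd (n e') ∧ v ∈ (e' : Sym2 V) then 1 else 0 : ℕ) = 0 := by
      refine Finset.sum_eq_zero fun e' he' => ?_
      have : e' ∉ avail n s := by rw [hA]; exact notMem_empty e'
      rw [mem_avail, not_and, not_not] at this
      simp [this (mem_unused.mp he')]
    have hdisj : Disjoint s.used (unused s) := by
      rw [Finset.disjoint_left]
      intro e' he' hM'
      exact (mem_unused.mp hM').2 he'
    have htrav : travAt n (stuck s) v = travAt n s v := by
      simp only [travAt, stuck]
      rw [Finset.sum_union hdisj, hM, add_zero]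
    rw [htrav]
    exact ⟨travAt n s v + (if v = s.pos then 1 else 0), rfl⟩

/-- **The traversed bonds form a trail from `a` to the current site**: every site has an even
number of traversed bonds at it, except `a` and the current site (when different). [folklore] -/
theorem even_travAt_walk (hrk : Function.Injective rk) (a : V) (k : ℕ) (v : V) :
    Even (travAt n (walk rk n Y a k) v + (if v = a then 1 else 0) +
      (if v = (walk rk n Y a k).pos then 1 else 0)) := by
  induction k with
  | zero =>
    rw [walk_zero, travAt_init]
    simp only [init]
    split_ifs
    · exact ⟨1, rfl⟩
    · exact ⟨0, rfl⟩
  | succ k ih =>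
    have h := even_travAt_step_add (n := n) (Y := Y) hrk (walk rk n Y a k) v
    rw [← walk_succ] at h
    rw [Nat.even_iff] at ih h ⊢
    omega

/-- With no available bond, the parity of the degree of the current site is that of its traversal
count (every bond at the site with odd current has been used, hence traversed). [folklore] -/
theorem odd_degree_iff_odd_travAt {s : State G} (hA : avail n s = ∅) :
    Odd (n.degree s.pos) ↔ Odd (travAt n s s.pos) := by
  have hterm : ∀ e : G.edgeFinset, (if s.pos ∈ (e : Sym2 V) then n e else 0) % 2 =
      (if e ∈ s.used then (if Odd (n e) ∧ s.pos ∈ (e : Sym2 V) then 1 else 0) else 0) := by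
    intro e
    by_cases hp : s.pos ∈ (e : Sym2 V)
    · by_cases hu : e ∈ s.used
      · rw [if_pos hp, if_pos hu]
        by_cases ho : Odd (n e)
        · rw [if_pos ⟨ho, hp⟩]; exact Nat.odd_iff.mp ho
        · rw [if_neg (fun h => ho h.1)]; exact Nat.even_iff.mp (Nat.not_odd_iff_even.mp ho)
      · have : e ∉ avail n s := by rw [hA]; exact notMem_empty e
        rw [mem_avail, not_and, not_not] at this
        rw [if_pos hp, if_neg hu, this ⟨hp, hu⟩]
    · rw [if_neg hp]
      split_ifs with h1 h2
      · exact absurd h2.2 hp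
      · rfl
      · rfl
  rw [Nat.odd_iff, Nat.odd_iff]
  unfold Current.degree travAt
  rw [Finset.sum_nat_mod, Finset.sum_congr rfl fun e _ => hterm e, Finset.sum_ite_mem, Finset.univ_inter]

/-- **Aizenman's observation** (1982, §9, p. 23): for a current with sources `{a} ∆ {b}` the walk
from `a` is never stuck away from `b` — a site with no available bond is `b`. [cite: AizenmanCMP1982, §9 (p. 23)] -/
theorem pos_eq_of_avail_eq_empty (hrk : Function.Injective rk) {a b : V}
    (hn : n.sources = {a} ∆ {b}) (k : ℕ) (hA : avail n (walk rk n Y a k) = ∅) :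
    (walk rk n Y a k).pos = b := by
  have hpar := even_travAt_walk (n := n) (Y := Y) hrk a k (walk rk n Y a k).pos
  rw [if_pos rfl] at hpar
  have hdeg := odd_degree_iff_odd_travAt (n := n) hA
  have hsrc := mem_sources_iff n (walk rk n Y a k).pos
  rw [hn, Finset.mem_symmDiff, mem_singleton, mem_singleton] at hsrc
  set s := walk rk n Y a k
  by_contra hb
  by_cases ha : s.pos = a
  · rw [if_pos ha] at hpar
    have h1 : ¬ Odd (travAt n s s.pos) := by
      rw [Nat.not_odd_iff_even]; rw [Nat.even_iff] at hpar ⊢; omega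
    rw [← hdeg, ← hsrc] at h1
    exact h1 (Or.inl ⟨ha, hb⟩)
  · rw [if_neg ha] at hpar
    have h1 : Odd (travAt n s s.pos) := by
      rw [Nat.odd_iff]; rw [Nat.even_iff] at hpar; omega
    rw [← hdeg, ← hsrc] at h1
    rcases h1 with ⟨h, -⟩ | ⟨h, -⟩
    · exact ha h
    · exact hb h

/-- **The walk from `a` with target `{b}` has halted at `b` after `|E| + 1` steps** when
`∂n = {a} ∆ {b}` (Aizenman 1982, §9 (iv) and the observation on p. 23: "if `∂n = {x, y}` then any
nonrepeating path along bonds with odd values of `n` which starts at `x`, eventually reaches `y`"). [cite: AizenmanCMP1982, §9 (p. 23)] -/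
theorem walk_done_of_sources_eq (hrk : Function.Injective rk) {a b : V}
    (hn : n.sources = {a} ∆ {b}) :
    (walk rk n {b} a (Fintype.card G.edgeFinset + 1)).done = true ∧
      (walk rk n {b} a (Fintype.card G.edgeFinset + 1)).pos = b := by
  set F := Fintype.card G.edgeFinset + 1 with hF
  have hdoneF : (walk rk n {b} a F).done = true := done_walk_card a
  classical
  have hex : ∃ k, (walk rk n {b} a k).done = true := ⟨F, hdoneF⟩
  have hk₀d : (walk rk n {b} a (Nat.find hex)).done = true := Nat.find_spec hex
  have hk₀pos : Nat.find hex ≠ 0 := by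
    intro h0
    have := hk₀d
    rw [h0, walk_zero] at this
    simp [init] at this
  obtain ⟨k, hk0⟩ := Nat.exists_eq_succ_of_ne_zero hk₀pos
  rw [hk0] at hk₀d
  have hk : (walk rk n {b} a k).done = false := by
    have := Nat.find_min hex (show k < Nat.find hex by omega)
    simpa using this
  have hk₀F : k + 1 ≤ F := by have := Nat.find_min' hex hdoneF; omega
  have hstep : (walk rk n {b} a (k + 1)).pos = b := by
    rw [walk_succ] at hk₀d ⊢
    set s := walk rk n {b} a k
    rcases step_cases (rk := rk) (n := n) (Y := {b}) s with ⟨hd, -⟩ | ⟨-, hY, hs⟩ | ⟨-, -, hA, hs⟩ | ⟨-, hY, hA, hs⟩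
    · rw [hk] at hd; exact absurd hd Bool.false_ne_true
    · rw [hs]; exact mem_singleton.mp hY
    · rw [hs] at hk₀d; simp [advance] at hk₀d
    · exact absurd (pos_eq_of_avail_eq_empty (Y := {b}) hrk hn k hA) (fun h => hY (mem_singleton.mpr h))
  rw [walk_eq_of_done hk₀F hk₀d]
  exact ⟨hk₀d, hstep⟩

/-- **Kirchhoff's node law for one current**: if `∂n = {a} ∆ {b}`, the total flux of the walk from
`a` to `b` out of `v` is `1{v = a} - 1{v = b}`. [cite: AizenmanCMP1982, §9 (p. 23)] -/
theorem sum_flux_eq_of_sources_eq (hrk : Function.Injective rk) {a b : V}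
    (hn : n.sources = {a} ∆ {b}) (v : V) :
    ∑ w, flux rk n {b} a v w = (if v = a then 1 else 0) - (if v = b then 1 else 0) := by
  rw [sum_flux_eq, (walk_done_of_sources_eq hrk hn).2]

end Trail

section Adjacent

variable {rk n Y}

/-- The walk moves only along bonds of the graph: the flux through a non-bond vanishes. [folklore] -/
theorem flux_eq_zero_of_not_adj {a v w : V} (h : ¬ G.Adj v w) : flux rk n Y a v w = 0 := by
  by_cases hvw : v = w
  · subst hvw; exact flux_self a v
  refine Finset.sum_eq_zero fun k _ => ?_
  have h1 : ¬ ((walk rk n Y a k).pos = v ∧ (walk rk n Y a (k + 1)).pos = w) := by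
    rintro ⟨h1, h2⟩
    have hne : (walk rk n Y a (k + 1)).pos ≠ (walk rk n Y a k).pos := by
      rw [h1, h2]; exact Ne.symm hvw
    have := adj_of_pos_walk_succ_ne hne
    rw [h1, h2] at this
    exact h this
  have h2 : ¬ ((walk rk n Y a k).pos = w ∧ (walk rk n Y a (k + 1)).pos = v) := by
    rintro ⟨h1', h2'⟩
    have hne : (walk rk n Y a (k + 1)).pos ≠ (walk rk n Y a k).pos := by
      rw [h1', h2']; exact hvw
    have := adj_of_pos_walk_succ_ne hne
    rw [h1', h2'] at this
    exact h this.symm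
  rw [if_neg h1, if_neg h2, sub_zero]

end Adjacent

end Backbone

/-! ### Currents with two sources exist along paths -/

/-- For `β > 0`, if `a` and `b` are connected in `G` then `∑_{∂n = {a} ∆ {b}} w_β(n) > 0`: one copy
of each edge of a simple path from `a` to `b` is a current with sources `{a, b}` (a vertex meets an
odd number of edges of a path iff it is an endpoint) and positive weight. [cite: DuminilCopin2016, §2.1] -/
theorem currentSum_pair_pos {β : ℝ} (hβ : 0 < β) {a b : V} (h : G.Reachable a b) :
    0 < currentSum G β ({a} ∆ {b}) := by
  classical
  by_cases hab : a = b
  · subst hab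
    rw [symmDiff_self, Finset.bot_eq_empty]
    exact currentSum_empty_pos' G β
  obtain ⟨p, hp⟩ : ∃ p : G.Walk a b, p.IsPath := h.elim_path fun q => ⟨q.1, q.2⟩
  have hnodup : p.edges.Nodup := hp.isTrail.edges_nodup
  set m : Current G := fun e => if (e : Sym2 V) ∈ p.edges then 1 else 0 with hm
  have hdeg : ∀ v, m.degree v = p.edges.countP fun e => v ∈ e := by
    intro v
    have h1 : ∀ e : G.edgeFinset, (if v ∈ (e : Sym2 V) then m e else 0) =
        if v ∈ (e : Sym2 V) ∧ (e : Sym2 V) ∈ p.edges then 1 else 0 := by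
      intro e
      by_cases hv : v ∈ (e : Sym2 V) <;> by_cases he : (e : Sym2 V) ∈ p.edges <;> simp [hm, hv, he]
    have h2 : m.degree v = ((p.edges.toFinset).filter fun e => v ∈ e).card := by
      simp only [degree]
      rw [Finset.sum_congr rfl fun e _ => h1 e, Finset.sum_boole, Nat.cast_id]
      refine Finset.card_bij (fun e _ => (e : Sym2 V)) (fun e he => ?_) (fun e₁ _ e₂ _ h => Subtype.ext h)
        (fun z hz => ?_)
      · rw [Finset.mem_filter] at he ⊢
        exact ⟨List.mem_toFinset.2 he.2.2, he.2.1⟩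
      · rw [Finset.mem_filter, List.mem_toFinset] at hz
        exact ⟨⟨z, SimpleGraph.mem_edgeFinset.2 (p.edges_subset_edgeSet hz.1)⟩, by
          rw [Finset.mem_filter]; exact ⟨Finset.mem_univ _, hz.2, hz.1⟩, rfl⟩
    have hset : (p.edges.toFinset).filter (fun e => v ∈ e) =
        (p.edges.filter fun e => decide (v ∈ e)).toFinset := by
      ext z
      simp
    rw [h2, hset, List.toFinset_card_of_nodup (hnodup.filter _), List.countP_eq_length_filter]
  have hsrc : m.sources = {a} ∆ {b} := by
    rw [symmDiff_singleton_eq_pair hab]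
    ext v
    rw [mem_sources_iff, Finset.mem_insert, Finset.mem_singleton, hdeg, ← Nat.not_even_iff_odd,
      hp.isTrail.even_countP_edges_iff v]
    constructor
    · intro hne
      by_contra hv
      exact hne fun _ => ⟨fun h1 => hv (Or.inl h1), fun h2 => hv (Or.inr h2)⟩
    · rintro (rfl | rfl) himp
      · exact (himp hab).1 rfl
      · exact (himp hab).2 rfl
  have hw : 0 < m.weight β :=
    Finset.prod_pos fun e _ => div_pos (pow_pos hβ _) (Nat.cast_pos.mpr (Nat.factorial_pos _))
  refine (summable_currentWeight_indicator_holds G β _).tsum_pos (fun n => ?_) m (by rw [if_pos hsrc]; exact hw)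
  split_ifs
  · exact weight_nonneg hβ.le n
  · exact le_rfl

end Current

/-! ### The mean backbone flux under the sourced random-current law -/

section Mean

variable (G)

/-- **The ranking-averaged mean backbone flux.** For the *sourced random-current law*
`P^{a,b}_{G,β}(n) = 1{∂n = {a} ∆ {b}} w_β(n) / ∑_{∂m = {a} ∆ {b}} w_β(m)` on currents of the finite graph
`G` (Aizenman 1982, §9; Aizenman–Duminil-Copin–Sidoravicius 2015, §2.1, Def. 2.1; Duminil-Copin 2016,
§2.1), the
expectation of the signed flux `Current.Backbone.flux` through the oriented bond `(v, w)` of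
Aizenman's walk from `a` with target `{b}` (1982, §9 (i)–(iv)), the bonds being examined in the order
of the ranking `e ↦ #(σ e)` and the result averaged over all permutations `σ` of the edges (so that
the examination rule does not break the symmetries of `G`). Written with `tsum` / `currentSum`; if no
current has sources `{a} ∆ {b}` the value is the junk value `0`. [cite: AizenmanCMP1982, §9 (i)–(iv) (p. 23)] -/
def backboneMeanFlux (β : ℝ) (a b v w : V) : ℝ :=
  ((Fintype.card (Equiv.Perm G.edgeFinset) : ℝ))⁻¹ *
    ∑ σ : Equiv.Perm G.edgeFinset,
      (∑' n : Current G, (if n.sources = {a} ∆ {b} then n.weight β else 0) *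
          Current.Backbone.flux (fun e => ((Fintype.equivFin G.edgeFinset (σ e) : ℕ))) n {b} a v w) /
        currentSum G β ({a} ∆ {b})

variable {G}

omit [DecidableEq V] in
/-- The ranking of the edges read off a permutation is injective. [folklore] -/
theorem rk_perm_injective (σ : Equiv.Perm G.edgeFinset) :
    Function.Injective fun e : G.edgeFinset => ((Fintype.equivFin G.edgeFinset (σ e) : ℕ)) :=
  fun _ _ h => σ.injective ((Fintype.equivFin G.edgeFinset).injective (Fin.ext h))

/-- Indicator-restricted weights times a function bounded by `1` are summable over all currents. [folklore] -/
theorem summable_indicator_weight_mul (β : ℝ) (A : Finset V) {F : Current G → ℝ} (hF : ∀ n, |F n| ≤ 1) :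
    Summable fun n : Current G => (if n.sources = A then n.weight β else 0) * F n := by
  refine (Current.summable_weight_abs G β).of_norm_bounded fun n => ?_
  rw [Real.norm_eq_abs, abs_mul]
  split_ifs
  · rw [Current.abs_weight]
    exact mul_le_of_le_one_right (Current.weight_nonneg (abs_nonneg β) n) (hF n)
  · rw [abs_zero, zero_mul]; exact Current.weight_nonneg (abs_nonneg β) n

/-- The sourced mean of a function bounded by `1` is bounded by `1` (`β ≥ 0`). [folklore] -/
theorem abs_tsum_indicator_weight_mul_div_le_one {β : ℝ} (hβ : 0 ≤ β) (A : Finset V) {F : Current G → ℝ}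
    (hF : ∀ n, |F n| ≤ 1) :
    |(∑' n : Current G, (if n.sources = A then n.weight β else 0) * F n) / currentSum G β A| ≤ 1 := by
  have hP : ∀ n : Current G, 0 ≤ (if n.sources = A then n.weight β else 0) := fun n => by
    split_ifs
    · exact Current.weight_nonneg hβ n
    · exact le_rfl
  have habs : ∀ n : Current G, |(if n.sources = A then n.weight β else 0) * F n| ≤
      (if n.sources = A then n.weight β else 0) := fun n => by
    rw [abs_mul, abs_of_nonneg (hP n)]
    exact mul_le_of_le_one_right (hP n) (hF n)
  have hsum := summable_indicator_weight_mul β A hF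
  have hle : |∑' n : Current G, (if n.sources = A then n.weight β else 0) * F n| ≤ currentSum G β A := by
    have h1 := norm_tsum_le_tsum_norm hsum.norm
    simp only [Real.norm_eq_abs] at h1
    refine h1.trans ?_
    unfold currentSum
    exact Summable.tsum_le_tsum habs hsum.abs (summable_currentWeight_indicator_holds G β A)
  rw [abs_div, abs_of_nonneg (currentSum_nonneg G hβ A)]
  exact div_le_one_of_le₀ hle (currentSum_nonneg G hβ A)

/-- **The mean backbone flux lies in `[-1, 1]`** (`β ≥ 0`): a bond is traversed at most once. [folklore] -/
theorem abs_backboneMeanFlux_le_one {β : ℝ} (hβ : 0 ≤ β) (a b v w : V) :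
    |backboneMeanFlux G β a b v w| ≤ 1 := by
  unfold backboneMeanFlux
  rw [abs_mul, abs_inv, Nat.abs_cast]
  have hc : (0 : ℝ) < Fintype.card (Equiv.Perm G.edgeFinset) := by exact_mod_cast Fintype.card_pos
  rw [inv_mul_le_iff₀ hc, mul_one]
  refine (Finset.abs_sum_le_sum_abs _ _).trans ?_
  refine (Finset.sum_le_sum fun σ _ => abs_tsum_indicator_weight_mul_div_le_one hβ _
    fun n => Current.Backbone.abs_flux_le_one _ _ _).trans ?_
  simp

/-- The mean backbone flux is antisymmetric in the bond. [folklore] -/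
theorem backboneMeanFlux_swap (β : ℝ) (a b v w : V) :
    backboneMeanFlux G β a b w v = -backboneMeanFlux G β a b v w := by
  unfold backboneMeanFlux
  rw [← mul_neg, ← Finset.sum_neg_distrib]
  congr 1
  refine Finset.sum_congr rfl fun σ _ => ?_
  rw [← neg_div, ← tsum_neg]
  congr 1
  refine tsum_congr fun n => ?_
  rw [Current.Backbone.flux_swap, mul_neg]

/-- The mean backbone flux through a degenerate bond vanishes. [folklore] -/
theorem backboneMeanFlux_self (β : ℝ) (a b v : V) : backboneMeanFlux G β a b v v = 0 := by
  simp [backboneMeanFlux, Current.Backbone.flux_self]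

/-- The mean backbone flux through a non-bond vanishes. [folklore] -/
theorem backboneMeanFlux_eq_zero_of_not_adj (β : ℝ) {a b v w : V} (h : ¬ G.Adj v w) :
    backboneMeanFlux G β a b v w = 0 := by
  simp [backboneMeanFlux, Current.Backbone.flux_eq_zero_of_not_adj h]

/-- **Kirchhoff's node law in expectation.** If some current has sources `{a} ∆ {b}` (e.g. `β > 0`
and `a`, `b` connected, `Current.currentSum_pair_pos`), the total mean flux out of `v` is
`1{v = a} - 1{v = b}`: the backbone is an edge-simple trail from `a` to `b`, hence a unit flow. [cite: AizenmanCMP1982, §9 (p. 23)] -/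
theorem sum_backboneMeanFlux_eq {β : ℝ} (a b v : V) (hZ : currentSum G β ({a} ∆ {b}) ≠ 0) :
    ∑ w, backboneMeanFlux G β a b v w = (if v = a then 1 else 0) - (if v = b then 1 else 0) := by
  set c0 : ℝ := (if v = a then 1 else 0) - (if v = b then 1 else 0) with hc0
  unfold backboneMeanFlux
  rw [← Finset.mul_sum, Finset.sum_comm]
  have hσ : ∀ σ : Equiv.Perm G.edgeFinset,
      ∑ w, (∑' n : Current G, (if n.sources = {a} ∆ {b} then n.weight β else 0) *
          Current.Backbone.flux (fun e => ((Fintype.equivFin G.edgeFinset (σ e) : ℕ))) n {b} a v w) /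
        currentSum G β ({a} ∆ {b}) = c0 := by
    intro σ
    rw [← Finset.sum_div, ← Summable.tsum_finsetSum (fun w _ => summable_indicator_weight_mul β _
      fun n => Current.Backbone.abs_flux_le_one _ _ _)]
    have hn : ∀ n : Current G, ∑ w, (if n.sources = {a} ∆ {b} then n.weight β else 0) *
        Current.Backbone.flux (fun e => ((Fintype.equivFin G.edgeFinset (σ e) : ℕ))) n {b} a v w =
        (if n.sources = {a} ∆ {b} then n.weight β else 0) * c0 := by
      intro n
      rw [← Finset.mul_sum]
      split_ifs with hs
      · rw [Current.Backbone.sum_flux_eq_of_sources_eq (rk_perm_injective σ) hs]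
      · rw [zero_mul, zero_mul]
    rw [tsum_congr hn, tsum_mul_right]
    change currentSum G β ({a} ∆ {b}) * c0 / currentSum G β ({a} ∆ {b}) = c0
    field_simp
  simp only [hσ, Finset.sum_const, Finset.card_univ, nsmul_eq_mul]
  rw [← mul_assoc, inv_mul_cancel₀ (by exact_mod_cast Fintype.card_ne_zero), one_mul]

end Mean

/-! ### The discrete torus -/

section Torus

variable {d : ℕ}

/-- **The mean backbone current on the torus.** For the sourced random current on the discrete torus
`(ℤ/(N+1)ℤ)^d` (`torusGraph d (N+1)`) at inverse temperature `β`, with sources the projections of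
`x, y ∈ ℤ^d`, the ranking-averaged mean signed flux `J_N(x, y; u, i)` of Aizenman's walk from `x̄`
to `ȳ` through the projection of the oriented bond `(u, u + eᵢ)` (Aizenman 1982, §9 (i)–(iv);
Aizenman–Duminil-Copin–Sidoravicius 2015, §2 for sourced currents on tori). This is
`backboneMeanFlux` of the torus graph; see `torusBackboneMeanCurrent_eq` for the explicit formula. [cite: AizenmanCMP1982, §9 (i)–(iv) (p. 23)] -/
def torusBackboneMeanCurrent (β : ℝ) (N : ℕ) (x y u : Site d) (i : Fin d) : ℝ :=
  backboneMeanFlux (torusGraph d (N + 1)) β (Torus.proj (N + 1) x) (Torus.proj (N + 1) y)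
    (Torus.proj (N + 1) u) (Torus.proj (N + 1) (u + Pi.single i 1))

/-- Unfolding of `torusBackboneMeanCurrent` through `backboneMeanFlux`. [folklore] -/
theorem torusBackboneMeanCurrent_def (β : ℝ) (N : ℕ) (x y u : Site d) (i : Fin d) :
    torusBackboneMeanCurrent β N x y u i =
      backboneMeanFlux (torusGraph d (N + 1)) β (Torus.proj (N + 1) x) (Torus.proj (N + 1) y)
        (Torus.proj (N + 1) u) (Torus.proj (N + 1) (u + Pi.single i 1)) :=
  rfl

/-- **Unfolding lemma**: `torusBackboneMeanCurrent` is the explicit ranking average, over all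
permutations `σ` of the edges of the torus, of the sourced mean of the signed number of steps of the
walk through the bond `(ū, ū + eᵢ)` among its first `|E| + 1` steps (the term inlined in route
`MeanCurrentCircleLaw` of summit CriticalPhenomena, with `Current.Backbone.walk` for the walk). [folklore] -/
theorem torusBackboneMeanCurrent_eq (β : ℝ) (N : ℕ) (x y u : Site d) (i : Fin d) :
    torusBackboneMeanCurrent β N x y u i =
      ((Fintype.card (Equiv.Perm (torusGraph d (N + 1)).edgeFinset) : ℝ))⁻¹ *
        ∑ σ : Equiv.Perm (torusGraph d (N + 1)).edgeFinset,
          (∑' n : Current (torusGraph d (N + 1)),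
              (if n.sources = {Torus.proj (N + 1) x} ∆ {Torus.proj (N + 1) y} then n.weight β else 0) *
                ∑ k ∈ range (Fintype.card (torusGraph d (N + 1)).edgeFinset + 1),
                  ((if (Current.Backbone.walk (fun e => ((Fintype.equivFin _ (σ e) : ℕ))) n
                          {Torus.proj (N + 1) y} (Torus.proj (N + 1) x) k).pos = Torus.proj (N + 1) u ∧
                        (Current.Backbone.walk (fun e => ((Fintype.equivFin _ (σ e) : ℕ))) n
                          {Torus.proj (N + 1) y} (Torus.proj (N + 1) x) (k + 1)).pos =
                          Torus.proj (N + 1) (u + Pi.single i 1) then (1 : ℝ) else 0) -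
                    (if (Current.Backbone.walk (fun e => ((Fintype.equivFin _ (σ e) : ℕ))) n
                          {Torus.proj (N + 1) y} (Torus.proj (N + 1) x) k).pos =
                          Torus.proj (N + 1) (u + Pi.single i 1) ∧
                        (Current.Backbone.walk (fun e => ((Fintype.equivFin _ (σ e) : ℕ))) n
                          {Torus.proj (N + 1) y} (Torus.proj (N + 1) x) (k + 1)).pos =
                          Torus.proj (N + 1) u then (1 : ℝ) else 0))) /
            currentSum (torusGraph d (N + 1)) β ({Torus.proj (N + 1) x} ∆ {Torus.proj (N + 1) y}) :=
  rfl

/-- `|J_N(x, y; u, i)| ≤ 1` for `β ≥ 0`. [folklore] -/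
theorem abs_torusBackboneMeanCurrent_le_one {β : ℝ} (hβ : 0 ≤ β) (N : ℕ) (x y u : Site d) (i : Fin d) :
    |torusBackboneMeanCurrent β N x y u i| ≤ 1 :=
  abs_backboneMeanFlux_le_one hβ _ _ _ _

/-- The projection to the torus is additive (cf. `Torus.proj_add` in `TwoPointLogConvex.lean`,
not importable here). [folklore] -/
private theorem proj_add_aux (L : ℕ) (u v : Site d) : Torus.proj L (u + v) = Torus.proj L u + Torus.proj L v := by
  ext j; simp [Torus.proj]

/-- The projection to the torus is subtractive. [folklore] -/
private theorem proj_sub_aux (L : ℕ) (u v : Site d) : Torus.proj L (u - v) = Torus.proj L u - Torus.proj L v := by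
  ext j; simp [Torus.proj]

/-- The projection of a coordinate vector. [folklore] -/
private theorem proj_single_aux (L : ℕ) (i : Fin d) (k : ℤ) :
    Torus.proj L (Pi.single i k : Site d) = Pi.single i (k : ZMod L) := by
  ext j
  by_cases h : j = i
  · subst h; simp [Torus.proj]
  · simp [Torus.proj, Pi.single_eq_of_ne h]

/-- Every site of the torus is reachable from every other along projected lattice paths. [folklore] -/
theorem torusGraph_reachable_proj (L : ℕ) (x y : Site d) :
    (torusGraph d L).Reachable (Torus.proj L x) (Torus.proj L y) := by
  have key : ∀ {x y : Site d}, (zdGraph d).Adj x y →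
      (torusGraph d L).Reachable (Torus.proj L x) (Torus.proj L y) := by
    intro x y hxy
    by_cases he : Torus.proj L x = Torus.proj L y
    · rw [he]
    · refine SimpleGraph.Adj.reachable ((torusGraph_adj_iff _ _).mpr ⟨he, ?_⟩)
      rcases (zdGraph_adj_iff x y).mp hxy with ⟨i, h | h⟩
      · exact Or.inl ⟨i, by rw [h, proj_add_aux, proj_single_aux, Int.cast_one]⟩
      · exact Or.inr ⟨i, by rw [h, proj_add_aux, proj_single_aux, Int.cast_one]⟩
  obtain ⟨p⟩ := zdGraph_reachable x y
  induction p with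
  | nil => rfl
  | cons hadj _ ih => exact (key hadj).trans ih

/-- On a torus of side `L ≥ 2` distinct coordinate vectors are distinct. [folklore] -/
theorem TorusSite.single_injective {L : ℕ} (hL : 2 ≤ L) :
    Function.Injective fun i : Fin d => (Pi.single i 1 : TorusSite d L) := by
  haveI : Fact (1 < L) := ⟨hL⟩
  intro i j h
  by_contra hij
  have := congrFun h i
  simp [Pi.single_eq_of_ne hij] at this

/-- On a torus of side `L ≥ 3` no coordinate vector is the negative of another. [folklore] -/
theorem TorusSite.single_ne_neg_single {L : ℕ} (hL : 3 ≤ L) (i j : Fin d) :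
    (Pi.single i 1 : TorusSite d L) ≠ -Pi.single j 1 := by
  haveI : Fact (1 < L) := ⟨by omega⟩
  intro h
  have hi := congrFun h i
  by_cases hij : i = j
  · subst hij
    simp only [Pi.neg_apply, Pi.single_eq_same] at hi
    have h2 : ((2 : ℕ) : ZMod L) = 0 := by
      rw [Nat.cast_ofNat]
      linear_combination hi
    have h3 := congrArg ZMod.val h2
    rw [ZMod.val_natCast, ZMod.val_zero, Nat.mod_eq_of_lt (by omega)] at h3
    omega
  · simp [Pi.single_eq_of_ne hij] at hi

/-- **Sums over the neighbours of a torus site.** For `L ≥ 3` a function vanishing off the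
neighbours of `v` sums to its values at the `2d` distinct sites `v ± eᵢ`. [folklore] -/
theorem TorusSite.sum_eq_of_adj {L : ℕ} [NeZero L] (hL : 3 ≤ L) (v : TorusSite d L) (F : TorusSite d L → ℝ)
    (hF : ∀ w, ¬ (torusGraph d L).Adj v w → F w = 0) :
    ∑ w, F w = ∑ i, F (v + Pi.single i 1) + ∑ i, F (v - Pi.single i 1) := by
  classical
  set φ : Fin d ⊕ Fin d → TorusSite d L :=
    Sum.elim (fun i => v + Pi.single i 1) (fun i => v - Pi.single i 1) with hφ
  have hinj : Function.Injective φ := by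
    rintro (i | i) (j | j) h
    · simp only [hφ, Sum.elim_inl, add_right_inj] at h
      rw [TorusSite.single_injective (by omega) h]
    · simp only [hφ, Sum.elim_inl, Sum.elim_inr, sub_eq_add_neg, add_right_inj] at h
      exact absurd h (TorusSite.single_ne_neg_single hL i j)
    · simp only [hφ, Sum.elim_inl, Sum.elim_inr, sub_eq_add_neg, add_right_inj] at h
      exact absurd h.symm (TorusSite.single_ne_neg_single hL j i)
    · simp only [hφ, Sum.elim_inr, sub_right_inj] at h
      rw [TorusSite.single_injective (by omega) h]
  have hsupp : ∀ w, F w ≠ 0 → w ∈ univ.image φ := by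
    intro w hw
    have hadj : (torusGraph d L).Adj v w := by
      by_contra h
      exact hw (hF w h)
    rw [torusGraph_adj_iff] at hadj
    obtain ⟨-, ⟨i, hi⟩ | ⟨i, hi⟩⟩ := hadj
    · exact mem_image.mpr ⟨Sum.inl i, mem_univ _, hi.symm⟩
    · exact mem_image.mpr ⟨Sum.inr i, mem_univ _, by simp [hφ, hi]⟩
  calc ∑ w, F w = ∑ w ∈ univ.image φ, F w := by
        symm
        refine Finset.sum_subset (subset_univ _) fun w _ hw => ?_
        by_contra h
        exact hw (hsupp w h)
    _ = ∑ j, F (φ j) := Finset.sum_image fun j _ j' _ h => hinj h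
    _ = ∑ i, F (v + Pi.single i 1) + ∑ i, F (v - Pi.single i 1) := by
        rw [Fintype.sum_sum_type]; rfl

/-- **Kirchhoff's node law on the torus** (exact conservation at every finite volume): for
`N ≥ 2` (side `N + 1 ≥ 3`, so that the `2d` bonds at a site are distinct) and `β > 0`,
`∑ᵢ (J_N(x,y;u,i) - J_N(x,y;u-eᵢ,i)) = 1{ū = x̄} - 1{ū = ȳ}`. Proof: telescoping of departures minus
arrivals along the walk, which starts at `x̄` and has halted at `ȳ`
(`Current.Backbone.walk_done_of_sources_eq`), `∑_n P(n) = 1`, average over the rankings. [cite: AizenmanCMP1982, §9 (p. 23)] -/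
theorem torusBackboneMeanCurrent_kirchhoff {N : ℕ} (hN : 2 ≤ N) {β : ℝ} (hβ : 0 < β) (x y u : Site d) :
    ∑ i, (torusBackboneMeanCurrent β N x y u i - torusBackboneMeanCurrent β N x y (u - Pi.single i 1) i) =
      (if Torus.proj (N + 1) u = Torus.proj (N + 1) x then 1 else 0) -
        (if Torus.proj (N + 1) u = Torus.proj (N + 1) y then 1 else 0) := by
  have hZ : currentSum (torusGraph d (N + 1)) β ({Torus.proj (N + 1) x} ∆ {Torus.proj (N + 1) y}) ≠ 0 :=
    (Current.currentSum_pair_pos hβ (torusGraph_reachable_proj (N + 1) x y)).ne'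
  have key := sum_backboneMeanFlux_eq (G := torusGraph d (N + 1)) (β := β)
    (Torus.proj (N + 1) x) (Torus.proj (N + 1) y) (Torus.proj (N + 1) u) hZ
  rw [TorusSite.sum_eq_of_adj (by omega) (Torus.proj (N + 1) u) _
    (fun w hw => backboneMeanFlux_eq_zero_of_not_adj β hw)] at key
  rw [← key, ← Finset.sum_add_distrib]
  refine Finset.sum_congr rfl fun i _ => ?_
  simp only [torusBackboneMeanCurrent]
  rw [sub_add_cancel, proj_add_aux, proj_sub_aux, proj_single_aux, Int.cast_one,
    backboneMeanFlux_swap β _ _ (Torus.proj (N + 1) u) (Torus.proj (N + 1) u - Pi.single i 1),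
    sub_neg_eq_add]

end Torus

end Literature.Probability.LatticeModels

end
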